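import Summits.AnomalousDissipation.AnomalousDissipation.Theorems.SoloBlindSweptStates
import Literature.Analysis.FluidPDE.BeltramiWavesCurl

/-!
# Swept Beltrami states: steady Navier–Stokes flows for every Beltrami-wave force
  (solo soloist, blind mode)

`SoloBlindSweptBeltrami` — the genuinely three-dimensional companion of `SoloBlindSweptStates`.
There the force was unidirectional (`S ⊂ ℤk₀`) and the nonlinearity of the swept state
`U_{ν,c} = c + Σ σ(k)⁻¹ f̂(k) e_k`, `σ(k) = 4π²ν|k|² + 2πi c·k`, was pure sweeping. Here the force
is any **Beltrami wave** `f = W = Σ_{ξ∈Λ} a_ξ B_ξ e_{λξ}` of the tree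
(`IntermittentBeltrami.beltramiField n a`, `λ = 5n`, `curl W = 2πλ W`; the ABC-type flows with
chaotic streamlines belong to this class), and the mechanism is the **Lamb identity**: the swept
amplitudes `σ(λξ)⁻¹ a_ξ` again satisfy the reality condition, so the oscillatory part
`W' = U_{ν,c} − c` of the swept state is itself a Beltrami wave, whence
`(W'·∇)W' = ∇(|W'|²/2) − W' × curl W' = ∇(|W'|²/2)` and

  `(U_{ν,c}·∇)U_{ν,c} = (c·∇)U_{ν,c} + ∇(|W'|²/2)`       (`convect_sweptState_beltrami`).

Consequently (`isSteadyNSState_sweptState_beltrami`) `U_{ν,c}` is a smooth steady state of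
`NS_ν(W)` with pressure `p = −|W'|²/2`, for every `n ≠ 0`, every admissible amplitude family `a`,
every momentum `c` and every `ν` with `σ ≠ 0` on `λΛ`. Since `U_{ν,c}` is literally the swept
state `sweptState ν c (λΛ) (coef n a)` of `SoloBlindSweptStates`, its energy, dissipation and
momentum are those computed there: bounded energy and `O(ν)` dissipation on every momentum leaf
on which `c·k ≠ 0` for all `k ∈ λΛ`.

Ingredients proved here in general form: the coordinates of the convective derivative
(`convect_apply_coord`), the gradient of `r‖W‖²` on the torus (`gradient_const_mul_norm_sq_apply`,
from Mathlib's `HasFDerivAt.norm_sq` on the re-centred lift), and the Lamb identity for fields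
with `curl W = μW` (`convect_self_eq_gradient_of_curl_eq_smul`).

**What it says about the summit** (`AnomalousDissipation` = `Literature.Turb.ZerothLaw`): the
screening of the force by a non-resonant mean flow, with vanishing dissipation at bounded energy,
is not a degeneracy of shear forces; it holds for the Beltrami (ABC-type) forces as well. An
a-priori derivation of the dissipation floor from bounded energy and the equations must therefore
fail for these forces too; only the momentum constraint or a selection principle can exclude the
swept branch.
[cite: LuoTiti2020, §3.2 Prop. 1] [cite: BuckmasterVicol2019AnnMath, Prop. 3.1]
[cite: Frisch1995, §5.2]
-/

open MeasureTheory Filter Topology Set UnitAddTorus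
open scoped ENNReal NNReal ComplexConjugate InnerProductSpace

noncomputable section

namespace Summit.AnomalousDissipation.AnomalousDissipation.Theorems

open Literature.Analysis.FunctionSpaces Literature.Analysis.FunctionSpaces.Torus
open Literature.Analysis.FluidPDE Literature.Analysis.FluidPDE.IntermittentBeltrami

/-! ### The Lamb identity for fields with `curl W = μ W` -/

/-- Coordinates of the convective derivative: `((W·∇)V)ᵢ = Σⱼ Wⱼ ∂ⱼVᵢ`. [folklore] -/
theorem convect_apply_coord {W V : UnitAddTorus (Fin 3) → EuclideanSpace ℝ (Fin 3)}
    (hV : IsSmooth V) (x : UnitAddTorus (Fin 3)) (i : Fin 3) :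
    Torus.convect W V x i = ∑ j, W x j * partialDeriv j V x i := by
  rw [Torus.convect, fderiv_apply_eq_sum_partialDeriv (hV.isContDiff (by simp)) x (W x)]
  simp only [WithLp.ofLp_sum, Finset.sum_apply, PiLp.smul_apply, smul_eq_mul]

/-- The torus gradient of `r‖W‖²` in coordinates: `∂ᵢ(r|W|²) = 2r Σⱼ Wⱼ ∂ᵢWⱼ`. [folklore] -/
theorem gradient_const_mul_norm_sq_apply {W : UnitAddTorus (Fin 3) → EuclideanSpace ℝ (Fin 3)}
    (hW : IsSmooth W) (r : ℝ) (x : UnitAddTorus (Fin 3)) (i : Fin 3) :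
    Torus.gradient (fun y => r * ‖W y‖ ^ 2) x i = 2 * r * ∑ j, W x j * partialDeriv i W x j := by
  have h1 : IsContDiff 1 W := hW.isContDiff (by simp)
  have hL : DifferentiableAt ℝ (liftAt W x) 0 :=
    ((h1.liftAt x).differentiable one_ne_zero).differentiableAt
  have hD : HasFDerivAt (fun v => r * ‖liftAt W x v‖ ^ 2)
      (r • (2 • (innerSL ℝ (liftAt W x 0)).comp (fderiv ℝ (liftAt W x) 0))) 0 :=
    hL.hasFDerivAt.norm_sq.const_mul r
  have hθ : liftAt (fun y => r * ‖W y‖ ^ 2) x = fun v => r * ‖liftAt W x v‖ ^ 2 := rfl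
  have key : ∀ v : EuclideanSpace ℝ (Fin 3), v i = ⟪v, EuclideanSpace.single i (1 : ℝ)⟫_ℝ :=
    fun v => by rw [EuclideanSpace.inner_single_right]; simp
  have hfd : fderiv ℝ (liftAt W x) 0 (EuclideanSpace.single i 1) = partialDeriv i W x :=
    (partialDeriv_eq_fderiv_apply h1 i x).symm
  rw [Torus.gradient, hθ, _root_.gradient, hD.fderiv, key, InnerProductSpace.toDual_symm_apply]
  simp only [_root_.smul_apply, ContinuousLinearMap.comp_apply, innerSL_apply_apply,
    liftAt_apply_zero, hfd, PiLp.inner_apply, RCLike.inner_apply, conj_trivial, smul_eq_mul,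
    nsmul_eq_mul, Nat.cast_ofNat]
  have hs : ∑ j, partialDeriv i W x j * W x j = ∑ j, W x j * partialDeriv i W x j :=
    Finset.sum_congr rfl fun j _ => mul_comm _ _
  rw [hs]
  ring

/-- **Lamb identity for Beltrami-type fields**: if `curl W = μ W` pointwise then
`(W·∇)W = ∇(|W|²/2)` (the Lamb vector `W × curl W` vanishes). [folklore] -/
theorem convect_self_eq_gradient_of_curl_eq_smul
    {W : UnitAddTorus (Fin 3) → EuclideanSpace ℝ (Fin 3)} (hW : IsSmooth W) {μ : ℝ}
    (hcurl : ∀ x, BDSV.curl W x = μ • W x) (x : UnitAddTorus (Fin 3)) :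
    Torus.convect W W x = Torus.gradient (fun y => (1 / 2 : ℝ) * ‖W y‖ ^ 2) x := by
  obtain ⟨h0, h1, h2⟩ := curl_apply_fin W x
  have hc : ∀ j, BDSV.curl W x j = μ * W x j := fun j => by
    rw [hcurl x, PiLp.smul_apply, smul_eq_mul]
  rw [hc 0] at h0
  rw [hc 1] at h1
  rw [hc 2] at h2
  ext i
  rw [convect_apply_coord hW, gradient_const_mul_norm_sq_apply hW]
  fin_cases i <;> simp only [Fin.sum_univ_three, Fin.isValue, Fin.zero_eta, Fin.mk_one,
    Fin.reduceFinMk]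
  · linear_combination (W x 1) * h2 - (W x 2) * h1
  · linear_combination (W x 2) * h0 - (W x 0) * h2
  · linear_combination (W x 0) * h1 - (W x 1) * h0

/-- `∇(−|W|²/2) = −∇(|W|²/2)`. [folklore] -/
theorem gradient_neg_half_norm_sq {W : UnitAddTorus (Fin 3) → EuclideanSpace ℝ (Fin 3)}
    (hW : IsSmooth W) (x : UnitAddTorus (Fin 3)) :
    Torus.gradient (fun y => (-(1 / 2) : ℝ) * ‖W y‖ ^ 2) x =
      -Torus.gradient (fun y => (1 / 2 : ℝ) * ‖W y‖ ^ 2) x := by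
  ext i
  rw [PiLp.neg_apply, gradient_const_mul_norm_sq_apply hW, gradient_const_mul_norm_sq_apply hW]
  ring

/-- `r‖W‖²` is smooth for smooth `W`. [folklore] -/
theorem isSmooth_const_mul_norm_sq {W : UnitAddTorus (Fin 3) → EuclideanSpace ℝ (Fin 3)}
    (hW : IsSmooth W) (r : ℝ) : IsSmooth (fun y => r * ‖W y‖ ^ 2) := by
  have h : (fun y => r * ‖W y‖ ^ 2) = r • fun y => ‖W y‖ ^ 2 := by
    funext y; simp [smul_eq_mul]
  rw [h]
  exact (hW.norm_sq).smul r

/-! ### Swept Beltrami waves -/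

/-- The zero frequency is not in `λΛ` for `λ = 5n ≠ 0`. [folklore] -/
theorem zero_not_mem_freqSet {n : ℤ} (hn : n ≠ 0) : (0 : Fin 3 → ℤ) ∉ freqSet n := by
  intro h
  obtain ⟨y, -, hy⟩ := Finset.mem_image.mp h
  have hn' : (5 * (n : ℝ)) ≠ 0 := mul_ne_zero (by norm_num) (Int.cast_ne_zero.mpr hn)
  have hq : ∀ q, dir y q = 0 := fun q => by
    have hq1 : ((kvec n y q : ℤ) : ℝ) = 0 := by rw [hy]; simp
    rw [kvec_cast] at hq1
    rcases mul_eq_zero.1 hq1 with h' | h'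
    · exact absurd h' hn'
    · exact h'
  have h1 := sum_dir_sq y
  simp [hq] at h1

/-- Off `λΛ` the Beltrami coefficients vanish; in particular `coef n a 0 = 0` for `n ≠ 0`.
[folklore] -/
theorem coef_eq_zero_of_not_mem {n : ℤ} (a : LIndex → ℂ) {k : Fin 3 → ℤ} (hk : k ∉ freqSet n) :
    coef n a k = 0 := by
  have h : Finset.univ.filter (fun y => kvec n y = k) = ∅ :=
    Finset.filter_eq_empty_iff.mpr fun y _ hy =>
      hk (Finset.mem_image.mpr ⟨y, Finset.mem_univ _, hy⟩)
  rw [coef, h, Finset.sum_empty]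

/-- **Swept amplitudes** `a'_ξ = σ(λξ)⁻¹ a_ξ`. [folklore] -/
def sweptAmp (ν : ℝ) (c : EuclideanSpace ℝ (Fin 3)) (n : ℤ) (a : LIndex → ℂ) (y : LIndex) : ℂ :=
  (sweptSymbol ν c (kvec n y))⁻¹ * a y

/-- The swept amplitudes satisfy the reality condition `a'_{-ξ} = conj a'_ξ`
(`σ(−k) = conj σ(k)`). [folklore] -/
theorem isCoefSymm_sweptAmp (ν : ℝ) (c : EuclideanSpace ℝ (Fin 3)) (n : ℤ) {a : LIndex → ℂ}
    (ha : IsCoefSymm a) : IsCoefSymm (sweptAmp ν c n a) := by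
  intro x b
  simp only [sweptAmp]
  rw [kvec_neg, sweptSymbol_neg, ha x b, map_mul, map_inv₀]

/-- **The swept coefficients of a Beltrami wave are Beltrami coefficients**:
`σ(k)⁻¹ coef(a)(k) = coef(a')(k)` for `k ≠ 0`. [folklore] -/
theorem sweptCoeff_coef (ν : ℝ) (c : EuclideanSpace ℝ (Fin 3)) (n : ℤ) (a : LIndex → ℂ)
    {k : Fin 3 → ℤ} (hk : k ≠ 0) :
    sweptCoeff ν c (coef n a) k = coef n (sweptAmp ν c n a) k := by
  rw [sweptCoeff_of_ne_zero ν c _ hk, coef, coef, Finset.smul_sum]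
  refine Finset.sum_congr rfl fun y hy => ?_
  rw [sweptAmp, (Finset.mem_filter.mp hy).2, smul_smul]

/-- **A swept Beltrami state is the momentum plus a Beltrami wave**:
`U_{ν,c} = c + W'`, `W' = Σ_ξ a'_ξ B_ξ e_{λξ}`. [folklore] -/
theorem sweptState_eq_beltrami (ν : ℝ) (c : EuclideanSpace ℝ (Fin 3)) {n : ℤ} (hn : n ≠ 0)
    (a : LIndex → ℂ) (x : UnitAddTorus (Fin 3)) :
    sweptState ν c (freqSet n) (coef n a) x = c + beltramiField n (sweptAmp ν c n a) x := by
  have h0 := zero_not_mem_freqSet hn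
  rw [sweptState, beltramiField, realTrigPoly_apply_eq_sum, realTrigPoly_apply_eq_sum,
    Finset.sum_insert h0, mFourier_zero, ContinuousMap.one_apply, one_smul, sweptCoeff_zero,
    EuclideanSpace.realPart_complexify]
  exact congrArg (fun v => c + v) (Finset.sum_congr rfl fun k hk => by
    rw [sweptCoeff_coef ν c n a (fun h : k = 0 => h0 (h ▸ hk))])

/-- The partial derivatives of a swept Beltrami state are those of its Beltrami part. [folklore] -/
theorem partialDeriv_sweptState_eq (ν : ℝ) (c : EuclideanSpace ℝ (Fin 3)) {n : ℤ} (hn : n ≠ 0)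
    (a : LIndex → ℂ) (i : Fin 3) (x : UnitAddTorus (Fin 3)) :
    partialDeriv i (sweptState ν c (freqSet n) (coef n a)) x =
      partialDeriv i (beltramiField n (sweptAmp ν c n a)) x := by
  have h0 := zero_not_mem_freqSet hn
  rw [sweptState, beltramiField, partialDeriv_realTrigPoly, partialDeriv_realTrigPoly,
    ← realTrigPoly_insert_zero h0 (by simp)]
  exact congrFun (realTrigPoly_congr fun k hk => by
    rw [sweptCoeff_coef ν c n a (fun h : k = 0 => h0 (h ▸ hk))]) x

/-- The sweeping part of the nonlinearity: `Σᵢ cᵢ ∂ᵢU = (c·∇)U`, with coefficients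
`2πi (c·k) Û(k)`. [folklore] -/
theorem sum_smul_partialDeriv_sweptState (ν : ℝ) (c : EuclideanSpace ℝ (Fin 3))
    (S : Finset (Fin 3 → ℤ)) (C : (Fin 3 → ℤ) → EuclideanSpace ℂ (Fin 3))
    (x : UnitAddTorus (Fin 3)) :
    ∑ i, c i • partialDeriv i (sweptState ν c S C) x =
      realTrigPoly (insert 0 S) (sweepCoeff ν c C) x := by
  have hpd : ∀ i, partialDeriv i (sweptState ν c S C) x =
      realTrigPoly (insert 0 S)
        (fun k => (2 * Real.pi * Complex.I * ((k i : ℤ) : ℂ)) • sweptCoeff ν c C k) x :=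
    fun i => by rw [sweptState, partialDeriv_realTrigPoly]
  have hadd : ∀ c₁ c₂ : (Fin 3 → ℤ) → EuclideanSpace ℂ (Fin 3),
      realTrigPoly (insert 0 S) c₁ x + realTrigPoly (insert 0 S) c₂ x =
        realTrigPoly (insert 0 S) (c₁ + c₂) x := fun c₁ c₂ => by
    rw [realTrigPoly_add]; rfl
  simp_rw [hpd, smul_realTrigPoly_apply]
  rw [Fin.sum_univ_three, hadd, hadd]
  refine congrFun (realTrigPoly_congr fun k _ => ?_) x
  simp only [Pi.add_apply, Pi.smul_apply, sweepCoeff, freqDot, Fin.sum_univ_three]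
  rw [← Complex.coe_smul, ← Complex.coe_smul, ← Complex.coe_smul, smul_smul, smul_smul, smul_smul,
    ← add_smul, ← add_smul]
  congr 1
  push_cast
  ring

/-- The Beltrami part of the nonlinearity of a swept Beltrami state:
`Σᵢ W'ᵢ ∂ᵢU = (W'·∇)W' = ∇(|W'|²/2)`. [folklore] -/
theorem sum_smul_partialDeriv_sweptState_beltrami (ν : ℝ) (c : EuclideanSpace ℝ (Fin 3)) {n : ℤ}
    (hn : n ≠ 0) (a : LIndex → ℂ) (x : UnitAddTorus (Fin 3)) :
    ∑ i, beltramiField n (sweptAmp ν c n a) x i •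
        partialDeriv i (sweptState ν c (freqSet n) (coef n a)) x =
      Torus.gradient (fun y => (1 / 2 : ℝ) * ‖beltramiField n (sweptAmp ν c n a) y‖ ^ 2) x := by
  have hW : IsSmooth (beltramiField n (sweptAmp ν c n a)) := isSmooth_beltramiField _ _
  have hW1 : IsContDiff 1 (beltramiField n (sweptAmp ν c n a)) := hW.isContDiff (by simp)
  simp_rw [partialDeriv_sweptState_eq ν c hn a]
  have h := convect_self_eq_gradient_of_curl_eq_smul hW (curl_beltramiField n (sweptAmp ν c n a)) x
  rw [Torus.convect, fderiv_apply_eq_sum_partialDeriv hW1 x] at h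
  exact h

/-- **The nonlinearity of a swept Beltrami state**: `(U·∇)U = (c·∇)U + ∇(|W'|²/2)`. [folklore] -/
theorem convect_sweptState_beltrami (ν : ℝ) (c : EuclideanSpace ℝ (Fin 3)) {n : ℤ} (hn : n ≠ 0)
    (a : LIndex → ℂ) (x : UnitAddTorus (Fin 3)) :
    Torus.convect (sweptState ν c (freqSet n) (coef n a))
        (sweptState ν c (freqSet n) (coef n a)) x =
      realTrigPoly (insert 0 (freqSet n)) (sweepCoeff ν c (coef n a)) x +
        Torus.gradient (fun y => (1 / 2 : ℝ) * ‖beltramiField n (sweptAmp ν c n a) y‖ ^ 2) x := by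
  have h1 : IsContDiff 1 (sweptState ν c (freqSet n) (coef n a)) :=
    (isSmooth_sweptState ν c _ _).isContDiff (by simp)
  rw [Torus.convect, fderiv_apply_eq_sum_partialDeriv h1, sweptState_eq_beltrami ν c hn a x,
    ← sum_smul_partialDeriv_sweptState ν c (freqSet n) (coef n a) x,
    ← sum_smul_partialDeriv_sweptState_beltrami ν c hn a x, ← Finset.sum_add_distrib]
  exact Finset.sum_congr rfl fun i _ => by rw [PiLp.add_apply, add_smul]

/-- **Swept Beltrami states are steady Navier–Stokes states.** For every `n ≠ 0`, every
amplitude family `a` with the reality condition, every momentum `c` and every `ν` with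
`σ(k) ≠ 0` on `λΛ` (`ν ≠ 0`, or `c·k ≠ 0` on `λΛ`), the swept state of the Beltrami-wave force
`W = beltramiField n a` solves `(U·∇)U = νΔU − ∇p + W`, `div U = 0`, with `p = −|W'|²/2`.
[folklore] -/
theorem isSteadyNSState_sweptState_beltrami {ν : ℝ} {c : EuclideanSpace ℝ (Fin 3)} {n : ℤ}
    (hn : n ≠ 0) {a : LIndex → ℂ} (hσ : ∀ k ∈ freqSet n, sweptSymbol ν c k ≠ 0) :
    Torus.IsSteadyNSState ν (beltramiField n a) (sweptState ν c (freqSet n) (coef n a))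
      (fun y => (-(1 / 2) : ℝ) * ‖beltramiField n (sweptAmp ν c n a) y‖ ^ 2) := by
  set S := freqSet n with hS
  set C := coef n a with hC
  set W := beltramiField n (sweptAmp ν c n a) with hWdef
  have h0 : (0 : Fin 3 → ℤ) ∉ S := zero_not_mem_freqSet hn
  have hC0 : C 0 = 0 := coef_eq_zero_of_not_mem a h0
  have hW : IsSmooth W := isSmooth_beltramiField _ _
  refine ⟨isSmoothSpaceTimeOn_const (isSmooth_sweptState ν c S C) _,
    isSmoothSpaceTimeOn_const (isSmooth_const_mul_norm_sq hW _) _, fun t _ y => ?_,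
    fun _ _ => isDivFree_sweptState ν c (isTransversal_coef n a)⟩
  have ht : Torus.timeDerivWithin Set.univ (fun _ : ℝ => sweptState ν c S C) t y = 0 := by
    simp [Torus.timeDerivWithin]
  have hlap : Torus.laplacian (sweptState ν c S C) y =
      realTrigPoly (insert 0 S) (sweptLapCoeff ν c C) y := laplacian_realTrigPoly _ _ y
  have hfun : realTrigPoly (insert 0 S) (sweepCoeff ν c C) =
      realTrigPoly (insert 0 S) (ν • sweptLapCoeff ν c C + C) :=
    realTrigPoly_congr fun k hk => by
      simpa only [Pi.smul_apply, Pi.add_apply] using sweptCoeff_balance hC0 hσ k hk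
  have hbal : realTrigPoly (insert 0 S) (sweepCoeff ν c C) y =
      ν • realTrigPoly (insert 0 S) (sweptLapCoeff ν c C) y + beltramiField n a y := by
    rw [beltramiField, ← hS, ← hC, realTrigPoly_insert_zero h0 hC0, smul_realTrigPoly_apply, hfun,
      realTrigPoly_add]
    rfl
  rw [ht, zero_add, convect_sweptState_beltrami ν c hn a y, hlap, gradient_neg_half_norm_sq hW,
    hbal, sub_neg_eq_add]
  abel

end Summit.AnomalousDissipation.AnomalousDissipation.Theorems

end
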